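import Summits.BirchSwinnertonDyer.Rank1Residual.X2.GreenbergVatsalTateKummerCyclotomic
import Summits.BirchSwinnertonDyer.Rank1Residual.X2.GreenbergVatsalTateDatumCofree
import Literature.NumberTheory.EllipticCurves.TateCurve.NumberFieldUniformizationTwistedTateJ
import HarnessLib

/-!
# T-42-mult in the kernel, XXVII: Greenberg's Prop. 2.4 «holds when `E` has multiplicative reduction»
# in LOCAL form at the completion `(F_∞)_η` of the cyclotomic `ℤ_p`-tower — EVERY prime `p`, the
# prime `2` included: a `C_v`-valued continuous cocycle of `G_{(F_∞)_η}` is a KUMMER coboundary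

Cell `bsd-2adic` (run/shared/lean/pub/bsd-2adic/), seat `bsd-2adic-t42` (BRIEF-T42), GEN 17. HONEST FRAMING:
research route; THEOREMS ONLY (no `def`, no named fact, no instance); nothing booked; nothing re-keyed
(RC-169); BSD is not proved by any of this. PARTITION: X5@2 multiplicative GV-transport rows (K4ᵐ B1·O1; the
two LOCAL statements `T2`, `δ2` at the prime `2` left of `hF3b` by XXVI
`…TwistedDescentLocalTwo.lean`) × p = 2 — types-the-object-of; bears_on K4 items 19922 / 19923
(`--supports stmt-BirchSwinnertonDyer-19923`).

## What

HOME/t42/DESIGN-T42-ADDENDUM-17.md §A17.3 (caveat): both remaining local statements `δ2` (dual Kummer at `2`)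
and `T2` (local descent at `2`) read Greenberg's Prop. 2.4-multiplicative in its printed LOCAL form over
`K = (F_∞)_η`: «`Im(κ_K) = Im(λ_K)`» (LNM 1716 §2 pp. 74–76), i.e. for classes of `H¹(G_K, E[p^∞])`, not only
for the restrictions of global classes of `H¹(F_∞, E[p^∞])` — the latter is the shape of the tree's named
fact `Greenberg1999.imKummer_ge_strictCondition_multiplicative_cyclotomic`, which IS a theorem
(`X2.GreenbergVatsalTateKummerCyclotomic.imKummer_ge_strictCondition_multiplicative_cyclotomic_holds`). The
kernel proof of that theorem is local: it only ever touches the restriction of the global cocycle to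
`G = (ker κ)_v = G_K`. This file re-runs it for an ARBITRARY continuous cocycle of `G`:

* `exists_kummerPoint_of_cocycle_mem_plus` — for Tate-parametrisation data `(q, t, Ψ)` at `v` (the clauses of
  `Silverman1994_thmV53_corV54_tateUniformisation`, a tree theorem) and the Tate line `C = ι⁻¹Ψ(μ)` (any
  `LocalDatum N` with that membership), EVERY continuous crossed homomorphism `f : G_K → E[p^∞]` with values
  in `C` is a Kummer coboundary: `ι(f τ) = τ•Q − Q` for some `Q ∈ E(F̄_v)`. Proof = Greenberg's, by name:
  `cd_p(G_K) ≤ 1 ⟹ H¹(K, C)` is `2`-divisible in cochain form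
  (`GreenbergVatsalTateKummerTwoDivisible.exists_cocycle_eq_two_nsmul_add_of_isCyclotomic`: `f = 2d + ∂c₀`),
  continuous Hilbert 90 on `G₁ = G ∩ Stab(t)` (`GreenbergVatsalTateKummerLocal.exists_point_of_values_in_roots`:
  `ι∘d = ∂P₂` on `G₁`), the index-`2` step across the quadratic character
  (`…exists_two_nsmul_eq_of_vanishing_on_stabilizer`: `2(ι∘d − ∂P₂) = ∂R`), so
  `ι∘f = ∂(R + 2P₂ + ιc₀)`;
* `exists_kummerPoint_of_cocycle_strict` — the same for a cocycle that is a coboundary MODULO `C`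
  (`f ≡ ∂m₀ mod C`: the class dies in `H¹(G_K, E[p^∞]/C)`, Greenberg's `Im(λ_K)`);
* `exists_tateLine_localKummer` — packaged at a multiplicative place `v ∣ p` of a number field (universe `0`,
  the universe of the tree's `cd ≤ 1` theorem): there is a `D_v`-stable, `p`-DIVISIBLE line `C ⊆ E[p^∞]` with
  `#C[p] = p` (`GreenbergVatsalTateDatumCofree`) such that every continuous `C`-valued cocycle of `G_K`, and
  every cocycle that is a coboundary modulo `C`, is a Kummer coboundary.

References: [GreenbergLNM1716] §2 Prop. 2.4 (pp. 74–75), pp. 75–76 («proposition 2.4 holds when E has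
multiplicative reduction»); [SerreGaloisCohomology1997] II §3.3 Prop. 9; [SerreLocalFields1979] X §1 Prop. 2;
[SilvermanATAEC1994] V.3.1, V.5.2–5.4; [GreenbergVatsal2000] §2 pp. 14–15.
-/

set_option autoImplicit false
set_option linter.dupNamespace false

noncomputable section

open scoped Classical AddSubgroup

namespace Summit.BirchSwinnertonDyer.BirchSwinnertonDyer.Theorems.MultTransportTwistedDescent

open NumberField IsDedekindDomain Field WeierstrassCurve
  Literature.NumberTheory.GaloisRepresentations Literature.NumberTheory.EllipticCurves
  Literature.NumberTheory.EllipticCurves.GreenbergSelmer IsDedekindDomain.HeightOneSpectrum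
  Summit.BirchSwinnertonDyer.Rank1Residual.X2
  Summit.BirchSwinnertonDyer.Rank1Residual.X2.GreenbergVatsalTateKummerLocal
  Summit.BirchSwinnertonDyer.Rank1Residual.X2.GreenbergVatsalTateKummerTwoDivisible

/-! ## §1 A `C`-valued cocycle of `G_K`, `K = (F_∞)_η`, is a Kummer coboundary -/

section TateData

variable {F : Type} [Field F] [NumberField F] (W : WeierstrassCurve F) [W.IsElliptic] (p : ℕ)
  [hp : Fact p.Prime] (κ : ZpExtension F p) {v : HeightOneSpectrum (𝓞 F)}
  (Ψ : Additive (AlgebraicClosure (v.adicCompletion F))ˣ →+ localPoints W (v.adicCompletion F))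
  (t : AlgebraicClosure (v.adicCompletion F)) {q : v.adicCompletion F}
  (hq0 : q ≠ 0) (hq1 : Valued.v q < 1)
  (hker : ∀ u : (AlgebraicClosure (v.adicCompletion F))ˣ, Ψ (Additive.ofMul u) = 0 →
    ∃ a : ℤ, (u : AlgebraicClosure (v.adicCompletion F)) =
      algebraMap (v.adicCompletion F) (AlgebraicClosure (v.adicCompletion F)) q ^ a)
  (hΨσ : ∀ (σ : absoluteGaloisGroup (v.adicCompletion F))
      (u : (AlgebraicClosure (v.adicCompletion F))ˣ),
    σ • Ψ (Additive.ofMul u) =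
      (if Field.absoluteGaloisGroup.toAlgEquiv (v.adicCompletion F) σ t = t then (1 : ℤ)
        else -1) •
      Ψ (Additive.ofMul (Units.map
        (Field.absoluteGaloisGroup.toAlgEquiv (v.adicCompletion F) σ :
          AlgebraicClosure (v.adicCompletion F) →* AlgebraicClosure (v.adicCompletion F)) u)))
  (hts : ∀ σ : absoluteGaloisGroup (v.adicCompletion F), σ • t = t ∨ σ • t = -t)
  (N : LocalDatum F (W.geomPrimaryTorsion p) v)
  (hN : ∀ m : W.geomPrimaryTorsion p, m ∈ N.plus ↔
    ∃ ζ : (AlgebraicClosure (v.adicCompletion F))ˣ, IsOfFinOrder ζ ∧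
      Ψ (Additive.ofMul ζ) = pointsMap W (v.adicCompletion F) (m : W.geomPoints))
  (hκ : κ.IsCyclotomic)

include hq0 hq1 hker hΨσ hts hN hκ in
/-- **Greenberg's Prop. 2.4-multiplicative at `K = (F_∞)_η`, LOCAL cochain form, any `p`**: for the Tate line
`C = ι⁻¹Ψ(μ)` of a parametrisation `Ψ : F̄_v^× → E(F̄_v)` (kernel `q^ℤ`, `0 < |q| < 1`, equivariant up to the
quadratic character of `t`), every continuous crossed homomorphism `f : G_K → E[p^∞]` of
`G_K = (ker κ)_v` with values in `C` is a Kummer coboundary: `ι(f τ) = τ•Q − Q` (`Q ∈ E(F̄_v)`). This is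
«`Im(λ_K) ⊆ Im(κ_K)`» (LNM 1716 p. 74, Prop. 2.4; p. 76 «proposition 2.4 holds when E has multiplicative
reduction») for LOCAL classes; proof = the tree's (`2`-divisibility from `cd_p(G_K) ≤ 1`, continuous Hilbert
90 on the stabiliser of `t`, index-`2` step). [cite: GreenbergLNM1716, §2 Prop. 2.4 (pp. 74–75) and pp. 75–76]
[cite: SerreLocalFields1979, Ch. X §1 Prop. 2] -/
theorem exists_kummerPoint_of_cocycle_mem_plus
    (f : localSubgroup κ.kerSubgroup (v.adicCompletion F) → W.geomPrimaryTorsion p)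
    (hfC : ∀ τ, f τ ∈ N.plus) (hfcont : Continuous f)
    (hfcoc : ∀ τ₁ τ₂, f (τ₁ * τ₂) = f τ₁ + resGal (K := F) (v.adicCompletion F)
      (τ₁ : absoluteGaloisGroup (v.adicCompletion F)) • f τ₂) :
    ∃ Q : localPoints W (v.adicCompletion F), ∀ τ : localSubgroup κ.kerSubgroup (v.adicCompletion F),
      pointsMap W (v.adicCompletion F) (f τ : W.geomPoints) =
        (τ : absoluteGaloisGroup (v.adicCompletion F)) • Q - Q := by
  -- `H¹(G, C)` is `2`-divisible: `f = 2 d + ∂c₀`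
  obtain ⟨d, c₀, hdC, -, hdcont, hdcoc, hd2⟩ :=
    exists_cocycle_eq_two_nsmul_add_of_isCyclotomic W p κ N hκ
      (exists_mem_plus_two_nsmul_eq W p Ψ N hN) f hfC hfcont hfcoc
  -- on `G₁ = G ∩ Stab(t)`: continuous Hilbert 90
  set G₁ := localSubgroup κ.kerSubgroup (v.adicCompletion F) ⊓
    MulAction.stabilizer (absoluteGaloisGroup (v.adicCompletion F)) t with hG₁
  have hG₁le : G₁ ≤ localSubgroup κ.kerSubgroup (v.adicCompletion F) := inf_le_left
  set d₁ : G₁ → W.geomPrimaryTorsion p := fun τ ↦ d (Subgroup.inclusion hG₁le τ) with hd₁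
  have hΨG : ∀ τ : G₁, ∀ u : (AlgebraicClosure (v.adicCompletion F))ˣ,
      (τ : absoluteGaloisGroup (v.adicCompletion F)) • Ψ (Additive.ofMul u) =
        Ψ (Additive.ofMul (Units.map
          (Field.absoluteGaloisGroup.toAlgEquiv (v.adicCompletion F) τ :
            AlgebraicClosure (v.adicCompletion F) →* AlgebraicClosure (v.adicCompletion F))
              u)) := by
    intro τ u
    have hτt : Field.absoluteGaloisGroup.toAlgEquiv (v.adicCompletion F) τ t = t := by
      rw [← Field.absoluteGaloisGroup.smul_def]
      exact MulAction.mem_stabilizer_iff.1 (Subgroup.mem_inf.1 τ.2).2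
    rw [hΨσ, if_pos hτt, one_zsmul]
  have hd₁coc : ∀ τ₁ τ₂ : G₁, d₁ (τ₁ * τ₂) =
      d₁ τ₁ + resGal (K := F) (v.adicCompletion F) (τ₁ : absoluteGaloisGroup (v.adicCompletion F)) •
        d₁ τ₂ := fun τ₁ τ₂ ↦
    hdcoc (Subgroup.inclusion hG₁le τ₁) (Subgroup.inclusion hG₁le τ₂)
  have hopen : IsOpen {τ : G₁ | d₁ τ = 0} := by
    have hset : {τ : G₁ | d₁ τ = 0} = (fun τ : G₁ ↦ d (Subgroup.inclusion hG₁le τ)) ⁻¹' {0} := by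
      ext τ
      simp only [Set.mem_setOf_eq, Set.mem_preimage, Set.mem_singleton_iff, hd₁]
    rw [hset]
    exact (isOpen_discrete _).preimage (hdcont.comp (continuous_inclusion hG₁le))
  have hC₁ : ∀ τ : G₁, ∃ ζ : (AlgebraicClosure (v.adicCompletion F))ˣ, IsOfFinOrder ζ ∧
      Ψ (Additive.ofMul ζ) = pointsMap W (v.adicCompletion F) (d₁ τ : W.geomPoints) :=
    fun τ ↦ (hN _).1 (hdC _)
  obtain ⟨P₂, hP₂⟩ := exists_point_of_values_in_roots W p Ψ hker hq0 hq1 G₁ hΨG d₁ hd₁coc hopen hC₁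
  -- the index-`2` step for `e = ι∘d − ∂P₂` on `G`
  set e : localSubgroup κ.kerSubgroup (v.adicCompletion F) → localPoints W (v.adicCompletion F) :=
    fun τ ↦ pointsMap W (v.adicCompletion F) (d τ : W.geomPoints) -
      ((τ : absoluteGaloisGroup (v.adicCompletion F)) • P₂ - P₂) with hedef
  have hecoc : ∀ τ₁ τ₂ : localSubgroup κ.kerSubgroup (v.adicCompletion F), e (τ₁ * τ₂) =
      e τ₁ + (τ₁ : absoluteGaloisGroup (v.adicCompletion F)) • e τ₂ := by
    intro τ₁ τ₂
    simp only [hedef]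
    rw [hdcoc, AddSubgroup.coe_add, map_add, primaryComponent.coe_smul, pointsMap_smul,
      Subgroup.coe_mul, mul_smul, smul_sub, smul_sub]
    abel
  have he1 : ∀ τ : localSubgroup κ.kerSubgroup (v.adicCompletion F),
      (τ : absoluteGaloisGroup (v.adicCompletion F)) • t = t → e τ = 0 := by
    intro τ hτ
    have hτ₁ : (τ : absoluteGaloisGroup (v.adicCompletion F)) ∈ G₁ :=
      Subgroup.mem_inf.2 ⟨τ.2, MulAction.mem_stabilizer_iff.2 hτ⟩
    have h := hP₂ ⟨τ, hτ₁⟩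
    simp only [hd₁] at h
    have e1 : Subgroup.inclusion hG₁le ⟨(τ : absoluteGaloisGroup (v.adicCompletion F)), hτ₁⟩ = τ :=
      Subtype.ext rfl
    rw [e1] at h
    simp only [hedef]
    rw [h, sub_self]
  obtain ⟨R, hR⟩ := exists_two_nsmul_eq_of_vanishing_on_stabilizer (F := F)
    (localSubgroup κ.kerSubgroup (v.adicCompletion F)) (fun τ ↦ hts τ) e hecoc he1
  -- assemble the Kummer point `Q = R + 2 P₂ + ι c₀`
  refine ⟨R + 2 • P₂ + pointsMap W (v.adicCompletion F) (c₀ : W.geomPoints), fun τ ↦ ?_⟩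
  have h2d : 2 • pointsMap W (v.adicCompletion F) (d τ : W.geomPoints) =
      2 • e τ + 2 • ((τ : absoluteGaloisGroup (v.adicCompletion F)) • P₂ - P₂) := by
    simp only [hedef]; rw [← smul_add, sub_add_cancel]
  rw [hd2, AddSubgroup.coe_add, map_add, AddSubmonoidClass.coe_nsmul, map_nsmul, h2d, hR,
    AddSubgroupClass.coe_sub, map_sub, primaryComponent.coe_smul, pointsMap_smul]
  simp only [smul_add, smul_sub, two_nsmul]
  abel

include hq0 hq1 hker hΨσ hts hN hκ in
/-- **The same for a cocycle that is a coboundary MODULO `C`** (`f ≡ ∂m₀ mod C` on `G_K`: the class of `f`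
dies in `H¹(G_K, E[p^∞]/C)`, i.e. lies in Greenberg's `Im(λ_K)`): `ι∘f` is a Kummer coboundary — «for
`K = (F_∞)_η` … `Im(κ_K) = Im(λ_K)`» in LOCAL form, the inclusion `Im(λ_K) ⊆ Im(κ_K)`.
[cite: GreenbergLNM1716, §2 Prop. 2.4 (pp. 74–75) and pp. 75–76] -/
theorem exists_kummerPoint_of_cocycle_strict
    (f : localSubgroup κ.kerSubgroup (v.adicCompletion F) → W.geomPrimaryTorsion p)
    (m₀ : W.geomPrimaryTorsion p)
    (hfC : ∀ τ, f τ - (resGal (K := F) (v.adicCompletion F)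
      (τ : absoluteGaloisGroup (v.adicCompletion F)) • m₀ - m₀) ∈ N.plus)
    (hfcont : Continuous f)
    (hfcoc : ∀ τ₁ τ₂, f (τ₁ * τ₂) = f τ₁ + resGal (K := F) (v.adicCompletion F)
      (τ₁ : absoluteGaloisGroup (v.adicCompletion F)) • f τ₂) :
    ∃ Q : localPoints W (v.adicCompletion F), ∀ τ : localSubgroup κ.kerSubgroup (v.adicCompletion F),
      pointsMap W (v.adicCompletion F) (f τ : W.geomPoints) =
        (τ : absoluteGaloisGroup (v.adicCompletion F)) • Q - Q := by
  -- `g₁ = f − ∂m₀` has values in `C`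
  set g₁ : localSubgroup κ.kerSubgroup (v.adicCompletion F) → W.geomPrimaryTorsion p := fun τ ↦
    f τ - (resGal (K := F) (v.adicCompletion F) τ • m₀ - m₀) with hg₁
  have hg₁coc : ∀ τ₁ τ₂ : localSubgroup κ.kerSubgroup (v.adicCompletion F), g₁ (τ₁ * τ₂) =
      g₁ τ₁ + resGal (K := F) (v.adicCompletion F) τ₁ • g₁ τ₂ := by
    intro τ₁ τ₂
    simp only [hg₁]
    rw [hfcoc, Subgroup.coe_mul, map_mul, mul_smul, smul_sub, smul_sub]
    abel
  have hg₁cont : Continuous g₁ := by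
    simp only [hg₁]
    refine Continuous.sub hfcont (Continuous.sub ?_ continuous_const)
    exact (W.continuous_smul_geomPrimaryTorsion p m₀).comp
      ((resGal (K := F) (v.adicCompletion F)).continuous_toFun.comp continuous_subtype_val)
  obtain ⟨Q₁, hQ₁⟩ := exists_kummerPoint_of_cocycle_mem_plus W p κ Ψ t hq0 hq1 hker hΨσ hts N hN hκ
    g₁ hfC hg₁cont hg₁coc
  refine ⟨Q₁ + pointsMap W (v.adicCompletion F) (m₀ : W.geomPoints), fun τ ↦ ?_⟩
  have hf : f τ = g₁ τ + (resGal (K := F) (v.adicCompletion F) τ • m₀ - m₀) := by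
    simp only [hg₁]; abel
  rw [hf, AddSubgroup.coe_add, map_add, hQ₁, AddSubgroupClass.coe_sub, map_sub,
    primaryComponent.coe_smul, pointsMap_smul]
  simp only [smul_add]
  abel

end TateData

/-! ## §2 Packaged at a multiplicative place: a divisible line `C ⊆ E[p^∞]` with `#C[p] = p` whose cocycles
over `(F_∞)_η` are Kummer -/

section Packaged

open Literature.NumberTheory.EllipticCurves.TateCurve

variable {F : Type} [Field F] [NumberField F] (W : WeierstrassCurve F) [W.IsElliptic] (p : ℕ)
  [hp : Fact p.Prime] (κ : ZpExtension F p) {v : HeightOneSpectrum (𝓞 F)}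

/-- **At a place `v ∣ p` of multiplicative reduction (split or non-split, any `p`) there is a Tate line
`C ⊆ E[p^∞]`** — stable under the decomposition group, `p`-divisible, with `#C[p] = p` — such that, for the
cyclotomic `ℤ_p`-extension `κ` and `K = (F_∞)_η` (`G_K = (ker κ)_v`): (i) every continuous `C`-valued crossed
homomorphism of `G_K` is a Kummer coboundary, and (ii) so is every continuous crossed homomorphism of `G_K`
into `E[p^∞]` that is a coboundary modulo `C`. The line is `ι⁻¹Ψ(μ)` for the twisted Tate uniformisation
`Ψ` of the tree (`exists_twistedTateUniformisation_tateJ`, Silverman *ATAEC* V.5.3); (i)/(ii) are §1.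
[cite: GreenbergLNM1716, §2 Prop. 2.4 (pp. 74–75) and pp. 75–76] [cite: GreenbergVatsal2000, §2 pp. 14–15]
[cite: SilvermanATAEC1994, Lemma V.5.2 (c), Thm. V.5.3] -/
theorem exists_tateLine_localKummer (hκ : κ.IsCyclotomic) (hv : W.HasMultiplicativeReductionAt v) :
    ∃ N : LocalDatum F (W.geomPrimaryTorsion p) v,
      (∀ c ∈ N.plus, ∃ c' ∈ N.plus, p • c' = c) ∧
      Nat.card ↥(N.plus ⊓ (↥(W.geomPrimaryTorsion p))[(p : ℤ)]) = p ∧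
      (∀ (f : localSubgroup κ.kerSubgroup (v.adicCompletion F) → W.geomPrimaryTorsion p),
        (∀ τ, f τ ∈ N.plus) → Continuous f →
        (∀ τ₁ τ₂, f (τ₁ * τ₂) = f τ₁ + resGal (K := F) (v.adicCompletion F)
          (τ₁ : absoluteGaloisGroup (v.adicCompletion F)) • f τ₂) →
        ∃ Q : localPoints W (v.adicCompletion F),
          ∀ τ : localSubgroup κ.kerSubgroup (v.adicCompletion F),
            pointsMap W (v.adicCompletion F) (f τ : W.geomPoints) =
              (τ : absoluteGaloisGroup (v.adicCompletion F)) • Q - Q) ∧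
      (∀ (f : localSubgroup κ.kerSubgroup (v.adicCompletion F) → W.geomPrimaryTorsion p)
        (m₀ : W.geomPrimaryTorsion p),
        (∀ τ, f τ - (resGal (K := F) (v.adicCompletion F)
          (τ : absoluteGaloisGroup (v.adicCompletion F)) • m₀ - m₀) ∈ N.plus) → Continuous f →
        (∀ τ₁ τ₂, f (τ₁ * τ₂) = f τ₁ + resGal (K := F) (v.adicCompletion F)
          (τ₁ : absoluteGaloisGroup (v.adicCompletion F)) • f τ₂) →
        ∃ Q : localPoints W (v.adicCompletion F),
          ∀ τ : localSubgroup κ.kerSubgroup (v.adicCompletion F),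
            pointsMap W (v.adicCompletion F) (f τ : W.geomPoints) =
              (τ : absoluteGaloisGroup (v.adicCompletion F)) • Q - Q) := by
  obtain ⟨q, t, Ψ, hq0, hq1, -, -, -, ht2, -, hker, hΨσ⟩ :=
    exists_twistedTateUniformisation_tateJ W v hv
  have hts := GreenbergVatsalTateKummer.smul_sqrt_eq_or W t ht2
  -- the `±`-equivariance of `Ψ`
  have hΦ : ∀ (σ : absoluteGaloisGroup (v.adicCompletion F))
      (u : (AlgebraicClosure (v.adicCompletion F))ˣ),
      σ • Ψ (Additive.ofMul u) = Ψ (Additive.ofMul (Units.map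
        (Field.absoluteGaloisGroup.toAlgEquiv (v.adicCompletion F) σ :
          AlgebraicClosure (v.adicCompletion F) →* AlgebraicClosure (v.adicCompletion F)) u)) ∨
      σ • Ψ (Additive.ofMul u) = -Ψ (Additive.ofMul (Units.map
        (Field.absoluteGaloisGroup.toAlgEquiv (v.adicCompletion F) σ :
          AlgebraicClosure (v.adicCompletion F) →* AlgebraicClosure (v.adicCompletion F)) u)) := by
    intro σ u
    rw [hΨσ σ u]
    split_ifs
    · exact Or.inl (one_zsmul _)
    · exact Or.inr (by rw [neg_one_zsmul])
  refine ⟨GreenbergVatsalTateDatum.tateDatum W p Ψ hΦ,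
    GreenbergVatsalTateDatumCofree.tateDatum_plus_divisible W p Ψ hΦ,
    GreenbergVatsalTateDatumCofree.natCard_tateDatum_plus_inf_torsionBy W p Ψ hΦ hq0 hq1
      (fun u h ↦ (hker u).1 h), ?_, ?_⟩
  · intro f hfC hfcont hfcoc
    exact exists_kummerPoint_of_cocycle_mem_plus W p κ Ψ t hq0 hq1 (fun u h ↦ (hker u).1 h) hΨσ hts
      _ (GreenbergVatsalTateDatum.mem_tateDatum_plus_iff hΦ) hκ f hfC hfcont hfcoc
  · intro f m₀ hfC hfcont hfcoc
    exact exists_kummerPoint_of_cocycle_strict W p κ Ψ t hq0 hq1 (fun u h ↦ (hker u).1 h) hΨσ hts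
      _ (GreenbergVatsalTateDatum.mem_tateDatum_plus_iff hΦ) hκ f m₀ hfC hfcont hfcoc

end Packaged

end Summit.BirchSwinnertonDyer.BirchSwinnertonDyer.Theorems.MultTransportTwistedDescent

end
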